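import Literature.Analysis.FluidPDE.NSEnergyEquality2D
import Literature.Analysis.FluidPDE.TwoHalfScalarSection
import Literature.Analysis.FluidPDE.TwoHalfSpectralSplit
import Literature.Analysis.FluidPDE.LerayHopfMomentum
import Literature.Analysis.FluidPDE.NSUniqueness2DParts
import HarnessLib

/-!
# The `2½`-dimensional descent of Leray–Hopf solutions: an `x₃`-invariant global Leray–Hopf
  solution on `T³` is a planar Leray–Hopf solution plus a weak sourced scalar

Analysis/FluidPDE file (theorem-only). Let `u` be a global Leray–Hopf weak solution on `T³`
(accepted `Torus.IsGlobalLerayHopf`, viscosity `ν > 0`) of the Navier–Stokes system driven by a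
steady force `f ∈ L²(T³)` invariant under the translations `x ↦ x + s e₃`, all of whose slices
`u t` are invariant under the same translations (the datum `u₀` being the arbitrary function of
the structure). Write `v t`, `θ t` for the planar and vertical sections of `u t` and `g`, `h` for
those of `f` (`u t = twoHalf (v t) (θ t)`, `f = twoHalf g h`, `TorusPlanarLift`). Then
(`Torus.IsGlobalLerayHopf.twoHalf_descent`) there are `L²` data `v₀`, `θ₀` on `T²` such that

* `v`, re-defined at `t = 0` by `v₀`, is a **global Leray–Hopf solution of the two-dimensional
  system** driven by `g` (with energy equalities), and
* `θ` is a **global weak solution of the sourced advection–diffusion equation**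
  `∂ₜθ + v·∇θ = νΔθ + h` from `θ₀` (accepted `Torus.IsWeakScalarTransportForced`).

This is the classical remark that `x₃`-independent three-dimensional flows are a planar
Navier–Stokes flow carrying a passively transported third component (Majda–Bertozzi 2002,
§2.3.1, Prop. 2.7), in the Leray–Hopf class (Bardos–Lopes Filho–Niu–Nussenzveig Lopes–Titi 2013,
§2). The weak formulations, the bounds and the weak continuity descend by testing against planar
and vertical lifts (`TwoHalfWeakSection`, `TwoHalfScalarSection`, `TwoHalfSpectralSplit`); the
energy inequalities of the planar part alone do **not** descend from those of `u` (they couple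
`v` and `θ`) — they are supplied by the two-dimensional energy equality in the energy class
(Lions–Prodi; `Torus.WeakNSEnergyClass.isLerayHopfOn_update_two`). The datum of `u` is first
replaced by its honest invariant representative (`Torus.IsLerayHopfOn.exists_invariant_datum`),
whose sections are `v₀`, `θ₀`; the free slice `t = 0` of `v` is reset to `v₀`.

## References

* A. J. Majda, A. L. Bertozzi, *Vorticity and Incompressible Flow* (CUP 2002), §2.3.1, Prop. 2.7.
* C. Bardos, M. C. Lopes Filho, D. Niu, H. J. Nussenzveig Lopes, E. S. Titi, SIAM J. Math.
  Anal. 45 (2013), §2. [BardosEtAl2013]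
* J.-L. Lions, G. Prodi, C. R. Acad. Sci. Paris 248 (1959), 3519–3521.
-/

noncomputable section

open MeasureTheory Set Filter Topology Function UnitAddTorus
open scoped ENNReal NNReal InnerProductSpace
open Literature.Analysis.FunctionSpaces Literature.Analysis.FunctionSpaces.Torus

namespace Literature.Analysis.FluidPDE

namespace Torus

section Descent

variable {ν T : ℝ} {f U₀ : UnitAddTorus (Fin 3) → EuclideanSpace ℝ (Fin 3)}
  {u₀ : UnitAddTorus (Fin 3) → EuclideanSpace ℝ (Fin 3)} {u : ℝ → UnitAddTorus (Fin 3) → EuclideanSpace ℝ (Fin 3)}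

/-! ### Re-based weak formulation in `2½`-dimensional form -/

/-- **The weak formulation of an invariant solution, in `2½`-dimensional form.** For an
`x₃`-invariant forced weak solution with `x₃`-invariant force, whose datum pairings agree with
those of an invariant `U₀`, the weak formulation holds with force, datum and solution written as
planar lifts of their sections. [folklore] -/
theorem IsWeakNSSolutionForcedOn.twoHalf_sections
    (hw : IsWeakNSSolutionForcedOn T ν (fun _ => f) u₀ u)
    (hfinv : ∀ (s : UnitAddCircle) (x : UnitAddTorus (Fin 3)), f (x + Pi.single (2 : Fin 3) s) = f x)
    (huinv : ∀ (t : ℝ) (s : UnitAddCircle) (x : UnitAddTorus (Fin 3)), u t (x + Pi.single (2 : Fin 3) s) = u t x)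
    (hU₀inv : ∀ (s : UnitAddCircle) (x : UnitAddTorus (Fin 3)), U₀ (x + Pi.single (2 : Fin 3) s) = U₀ x)
    (hpair : ∀ w : UnitAddTorus (Fin 3) → EuclideanSpace ℝ (Fin 3), MemLp w 2 volume →
      ∫ x, ⟪u₀ x, w x⟫_ℝ = ∫ x, ⟪U₀ x, w x⟫_ℝ) :
    IsWeakNSSolutionForcedOn T ν
      (fun _ => twoHalf (fun y => planarProjE (f (planarSect y))) (fun y => f (planarSect y) 2))
      (twoHalf (fun y => planarProjE (U₀ (planarSect y))) (fun y => U₀ (planarSect y) 2))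
      (fun t => twoHalf (fun y => planarProjE (u t (planarSect y))) (fun y => u t (planarSect y) 2)) := by
  rw [← eq_twoHalf_of_forall_add_single' hfinv, ← eq_twoHalf_of_forall_add_single' hU₀inv]
  have hu : (fun t => twoHalf (fun y => planarProjE (u t (planarSect y))) (fun y => u t (planarSect y) 2)) = u :=
    funext fun t => (eq_twoHalf_of_forall_add_single' (huinv t)).symm
  rw [hu]
  exact hw.congr_datum_of_forall_integral_inner_eq hpair

/-- Every slice of an invariant global Leray–Hopf solution at a time `t ≥ 0` is in `L²`, hence so
are its sections. [folklore] -/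
theorem IsGlobalLerayHopf.memLp_sections (hLH : IsGlobalLerayHopf ν (fun _ => f) u₀ u)
    (huinv : ∀ (t : ℝ) (s : UnitAddCircle) (x : UnitAddTorus (Fin 3)), u t (x + Pi.single (2 : Fin 3) s) = u t x)
    {t : ℝ} (ht : 0 ≤ t) :
    MemLp (fun y => planarProjE (u t (planarSect y))) 2 volume ∧ MemLp (fun y => u t (planarSect y) 2) 2 volume := by
  have hmem : MemLp (u t) 2 volume := (hLH (t + 1) (by linarith)).memLp t ⟨ht, by linarith⟩
  rw [eq_twoHalf_of_forall_add_single' (huinv t)] at hmem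
  exact memLp_of_twoHalf hmem

/-! ### The planar section in the energy class -/

variable (hν : 0 < ν) (hf : MemLp f 2 volume)
  (hfinv : ∀ (s : UnitAddCircle) (x : UnitAddTorus (Fin 3)), f (x + Pi.single (2 : Fin 3) s) = f x)
  (hLH : IsGlobalLerayHopf ν (fun _ => f) u₀ u)
  (huinv : ∀ (t : ℝ) (s : UnitAddCircle) (x : UnitAddTorus (Fin 3)), u t (x + Pi.single (2 : Fin 3) s) = u t x)
  (hU₀ : MemLp U₀ 2 volume)
  (hU₀inv : ∀ (s : UnitAddCircle) (x : UnitAddTorus (Fin 3)), U₀ (x + Pi.single (2 : Fin 3) s) = U₀ x)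
  (hpair : ∀ w : UnitAddTorus (Fin 3) → EuclideanSpace ℝ (Fin 3), MemLp w 2 volume →
    ∫ x, ⟪u₀ x, w x⟫_ℝ = ∫ x, ⟪U₀ x, w x⟫_ℝ)
include hν hf hfinv hLH huinv hU₀ hU₀inv hpair

omit hν in
/-- **The planar section of an invariant global Leray–Hopf solution is a global Leray–Hopf
solution of the two-dimensional system** (re-defined at `t = 0` by the planar section of the
honest datum): the weak formulation, the `L^∞L²` bound, the `L²` slices, the spectral `L²H¹`
regularity and the weak `L²`-continuity descend from `u` (`TwoHalfWeakSection`,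
`TwoHalfSpectralSplit`, `TwoHalfSection`), and the two-dimensional energy equality in the energy
class makes it Leray–Hopf (`Torus.WeakNSEnergyClass.isLerayHopfOn_update_two`; Lions–Prodi 1959;
Bardos–Lopes Filho–Niu–Nussenzveig Lopes–Titi 2013, §2). [cite: BardosEtAl2013, §2] -/
theorem IsGlobalLerayHopf.isGlobalLerayHopf_planarSection :
    IsGlobalLerayHopf ν (fun _ => fun y => planarProjE (f (planarSect y)))
      (fun y => planarProjE (U₀ (planarSect y)))
      (Function.update (fun t y => planarProjE (u t (planarSect y))) 0 (fun y => planarProjE (U₀ (planarSect y)))) := by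
  -- notation
  set g : UnitAddTorus (Fin 2) → EuclideanSpace ℝ (Fin 2) := fun y => planarProjE (f (planarSect y)) with hg
  set h : UnitAddTorus (Fin 2) → ℝ := fun y => f (planarSect y) 2 with hh
  set V : ℝ → UnitAddTorus (Fin 2) → EuclideanSpace ℝ (Fin 2) := fun t y => planarProjE (u t (planarSect y)) with hV
  set Θ : ℝ → UnitAddTorus (Fin 2) → ℝ := fun t y => u t (planarSect y) 2 with hΘ
  set V₀ : UnitAddTorus (Fin 2) → EuclideanSpace ℝ (Fin 2) := fun y => planarProjE (U₀ (planarSect y)) with hV₀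
  set Θ₀ : UnitAddTorus (Fin 2) → ℝ := fun y => U₀ (planarSect y) 2 with hΘ₀
  have hfe : f = twoHalf g h := eq_twoHalf_of_forall_add_single' hfinv
  have hue : ∀ t, u t = twoHalf (V t) (Θ t) := fun t => eq_twoHalf_of_forall_add_single' (huinv t)
  have hU₀e : U₀ = twoHalf V₀ Θ₀ := eq_twoHalf_of_forall_add_single' hU₀inv
  have hgV₀ : MemLp g 2 volume ∧ MemLp h 2 volume := by
    have h1 := hf; rw [hfe] at h1; exact memLp_of_twoHalf h1
  have hV₀Θ₀ : MemLp V₀ 2 volume ∧ MemLp Θ₀ 2 volume := by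
    have h1 := hU₀; rw [hU₀e] at h1; exact memLp_of_twoHalf h1
  have hsec : ∀ t, 0 ≤ t → MemLp (V t) 2 volume ∧ MemLp (Θ t) 2 volume := fun t ht =>
    IsGlobalLerayHopf.memLp_sections hLH huinv ht
  refine WeakNSEnergyClass.isGlobalLerayHopf_update_two (fun T hT => ?_) (fun T hT => ?_) (fun t ht => (hsec t ht).1)
    (fun T hT => ?_) (fun T hT => ?_) hV₀Θ₀.1 (fun T _ => aestronglyMeasurable_stLift_steady hgV₀.1.1 _) (fun T hT => ?_)
  · -- the weak formulation
    have hw3 := (hLH T hT).weak.twoHalf_sections hfinv huinv hU₀inv hpair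
    exact isWeakNSSolutionForcedOn_of_twoHalf hw3 (fun t ht => (hsec t ht.1.le).1) hV₀Θ₀.1
      (fun _ _ => hgV₀.1.integrable one_le_two)
  · -- `L^∞ L²`
    obtain ⟨C, hC⟩ := (hLH T hT).energy_bound
    refine ⟨C, hC.mono fun t ht => ?_⟩
    rw [hue t] at ht
    exact (lintegral_enorm_sq_left_le_twoHalf (V t) (Θ t)).trans ht
  · -- `L² H¹`
    have hH := (hLH T hT).memL2Sobolev
    have hH' : MemL2Sobolev 0 T 1 (fun t => EuclideanSpace.complexify ∘ twoHalf (V t) (Θ t)) := by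
      have e : (fun t => EuclideanSpace.complexify ∘ u t) = fun t => EuclideanSpace.complexify ∘ twoHalf (V t) (Θ t) :=
        funext fun t => by rw [hue t]
      rwa [e] at hH
    refine (memL2Sobolev_of_twoHalf ?_ hH').1
    filter_upwards [ae_restrict_mem measurableSet_Ioo] with t ht
    exact ⟨(hsec t ht.1.le).1.integrable one_le_two, (hsec t ht.1.le).2.integrable one_le_two⟩
  · -- weak `L²` continuity with weak limit `V₀`
    intro w hw
    obtain ⟨hc, hlim⟩ := (hLH T hT).weak_continuous (twoHalf w 0) (memLp_twoHalf one_le_two hw MemLp.zero)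
    have heq : ∀ t, 0 ≤ t → (∫ x, ⟪u t x, twoHalf w 0 x⟫_ℝ) = ∫ y, ⟪V t y, w y⟫_ℝ := fun t ht => by
      rw [hue t]
      exact integral_inner_twoHalf_planar (hsec t ht).1 hw (Θ t)
    refine ⟨hc.congr fun t ht => (heq t ht.1.le).symm, ?_⟩
    rw [hpair _ (memLp_twoHalf one_le_two hw MemLp.zero), hU₀e, integral_inner_twoHalf_planar hV₀Θ₀.1 hw Θ₀] at hlim
    refine hlim.congr' ?_
    filter_upwards [Ioo_mem_nhdsGT hT] with t ht
    exact heq t ht.1.le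
  · -- the force is in `L¹(0,T;L²)`
    refine ⟨ae_of_all _ fun _ => hgV₀.1, ?_⟩
    have : IsFiniteMeasure (volume.restrict (Ioo (0 : ℝ) T)) := ⟨by
      rw [Measure.restrict_apply_univ]; exact measure_Ioo_lt_top⟩
    show eLpNorm (fun _ : ℝ => (eLpNorm g 2 volume).toReal) 1 (volume.restrict (Ioo 0 T)) < ⊤
    exact (memLp_const _).eLpNorm_lt_top

/-- **The vertical section of an invariant global Leray–Hopf solution is a global weak sourced
scalar** driven by the planar section (re-defined at `t = 0`), with source the vertical section
of the force and datum the vertical section of the honest datum (`TwoHalfScalarSection`; the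
`L^∞L²` bound at every `t` comes from the energy inequality of `u`). [cite: BardosEtAl2013, §2] -/
theorem IsGlobalLerayHopf.isWeakScalarTransportForced_verticalSection :
    IsWeakScalarTransportForced ν
      (Function.update (fun t y => planarProjE (u t (planarSect y))) 0 (fun y => planarProjE (U₀ (planarSect y))))
      (fun _ => fun y => f (planarSect y) 2) (fun y => U₀ (planarSect y) 2) (fun t y => u t (planarSect y) 2) := by
  intro T hT
  set g : UnitAddTorus (Fin 2) → EuclideanSpace ℝ (Fin 2) := fun y => planarProjE (f (planarSect y)) with hg
  set h : UnitAddTorus (Fin 2) → ℝ := fun y => f (planarSect y) 2 with hh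
  set V : ℝ → UnitAddTorus (Fin 2) → EuclideanSpace ℝ (Fin 2) := fun t y => planarProjE (u t (planarSect y)) with hV
  set Θ : ℝ → UnitAddTorus (Fin 2) → ℝ := fun t y => u t (planarSect y) 2 with hΘ
  set V₀ : UnitAddTorus (Fin 2) → EuclideanSpace ℝ (Fin 2) := fun y => planarProjE (U₀ (planarSect y)) with hV₀
  set Θ₀ : UnitAddTorus (Fin 2) → ℝ := fun y => U₀ (planarSect y) 2 with hΘ₀
  have hfe : f = twoHalf g h := eq_twoHalf_of_forall_add_single' hfinv
  have hue : ∀ t, u t = twoHalf (V t) (Θ t) := fun t => eq_twoHalf_of_forall_add_single' (huinv t)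
  have hU₀e : U₀ = twoHalf V₀ Θ₀ := eq_twoHalf_of_forall_add_single' hU₀inv
  have hgh : MemLp g 2 volume ∧ MemLp h 2 volume := by
    have h1 := hf; rw [hfe] at h1; exact memLp_of_twoHalf h1
  have hV₀Θ₀ : MemLp V₀ 2 volume ∧ MemLp Θ₀ 2 volume := by
    have h1 := hU₀; rw [hU₀e] at h1; exact memLp_of_twoHalf h1
  have H := hLH T hT
  -- the `L^∞ L²` bound at every time
  obtain ⟨M, hM, hbound⟩ := H.exists_forall_lintegral_enorm_sq_le hν.le
    (aestronglyMeasurable_stLift_steady hf.1 _) (lintegral_enorm_sq_steady_lt_top' hf T)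
  have hw3 := H.weak.twoHalf_sections hfinv huinv hU₀inv hpair
  have hscal : IsWeakScalarTransportForcedOn T ν V (fun _ => h) Θ₀ Θ := by
    refine isWeakScalarTransportForcedOn_of_twoHalf hw3 (fun t ht => ?_) (C := M.toNNReal) (fun t ht => ?_) hV₀Θ₀.2
      hgh.2.1.comp_snd ?_
    · have hm := H.memLp t (Ioo_subset_Icc_self ht)
      rwa [hue t] at hm
    · rw [ENNReal.coe_toNNReal hM, ← hue t]
      exact hbound t (Ioo_subset_Icc_self ht)
    · show ∫⁻ _ in Ioo (0 : ℝ) T, ∫⁻ y, ‖h y‖ₑ < ⊤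
      rw [setLIntegral_const]
      exact ENNReal.mul_lt_top (hgh.2.integrable one_le_two).2 measure_Ioo_lt_top
  exact hscal.congr_velocity_of_eqOn_Ioo fun t ht => Function.update_of_ne ht.1.ne' _ _

omit hν hf hfinv hLH huinv hU₀ hU₀inv hpair

/-! ### The descent theorem -/

/-- **The `2½`-dimensional descent of global Leray–Hopf solutions.** Let `u` be a global
Leray–Hopf solution on `T³` (`ν > 0`) driven by a steady force `f ∈ L²` invariant under
`x ↦ x + s e₃`, all of whose slices are invariant under the same translations. Then there are
`v₀, θ₀ ∈ L²(T²)` such that the planar section `t ↦ (y ↦ (u t (σ y))₁,₂)`, re-defined at `t = 0`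
by `v₀`, is a global Leray–Hopf solution of the two-dimensional system driven by the planar
section of `f`, and the vertical section `t ↦ (y ↦ (u t (σ y))₃)` is a global weak solution of
the sourced advection–diffusion equation driven by it, with source the vertical section of `f`
and datum `θ₀` (Majda–Bertozzi 2002, §2.3.1, Prop. 2.7; Bardos–Lopes Filho–Niu–Nussenzveig
Lopes–Titi 2013, §2; two-dimensional energy equality: Lions–Prodi 1959). [cite: BardosEtAl2013, §2] -/
theorem IsGlobalLerayHopf.twoHalf_descent (hν : 0 < ν) (hf : MemLp f 2 volume)
    (hfinv : ∀ (s : UnitAddCircle) (x : UnitAddTorus (Fin 3)), f (x + Pi.single (2 : Fin 3) s) = f x)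
    (hLH : IsGlobalLerayHopf ν (fun _ => f) u₀ u)
    (huinv : ∀ (t : ℝ) (s : UnitAddCircle) (x : UnitAddTorus (Fin 3)), u t (x + Pi.single (2 : Fin 3) s) = u t x) :
    ∃ (v₀ : UnitAddTorus (Fin 2) → EuclideanSpace ℝ (Fin 2)) (θ₀ : UnitAddTorus (Fin 2) → ℝ),
      MemLp v₀ 2 volume ∧ MemLp θ₀ 2 volume ∧
      IsGlobalLerayHopf ν (fun _ => fun y => planarProjE (f (planarSect y))) v₀
        (Function.update (fun t y => planarProjE (u t (planarSect y))) 0 v₀) ∧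
      IsWeakScalarTransportForced ν (Function.update (fun t y => planarProjE (u t (planarSect y))) 0 v₀)
        (fun _ => fun y => f (planarSect y) 2) θ₀ (fun t y => u t (planarSect y) 2) := by
  obtain ⟨U₀, hU₀, hU₀inv, hpair⟩ := (hLH 1 one_pos).exists_invariant_datum one_pos (i := (2 : Fin 3)) huinv
  have hU₀e : U₀ = twoHalf (fun y => planarProjE (U₀ (planarSect y))) (fun y => U₀ (planarSect y) 2) :=
    eq_twoHalf_of_forall_add_single' hU₀inv
  have hV₀Θ₀ : MemLp (fun y => planarProjE (U₀ (planarSect y))) 2 volume ∧ MemLp (fun y => U₀ (planarSect y) 2) 2 volume := by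
    have h1 := hU₀; rw [hU₀e] at h1; exact memLp_of_twoHalf h1
  exact ⟨_, _, hV₀Θ₀.1, hV₀Θ₀.2,
    IsGlobalLerayHopf.isGlobalLerayHopf_planarSection hf hfinv hLH huinv hU₀ hU₀inv hpair,
    IsGlobalLerayHopf.isWeakScalarTransportForced_verticalSection hν hf hfinv hLH huinv hU₀ hU₀inv hpair⟩

end Descent

end Torus

end Literature.Analysis.FluidPDE

end
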